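import Mathlib
import HarnessLib

/-!
# Friedlander–Iwaniec, *The polynomial `X² + Y⁴` captures its primes*, §12 (12.13)–(12.14), `x`-side:
# the smooth cutoff `g` and the `L¹` norm of the Fourier transform of `g(|x|)|x|^{2πit}`

[FI, §12, pp. 46–51 of arXiv:math/9811185 = Ann. of Math. 148 (1998) 945–1040].  After the smooth
majorant `f` is attached ((12.6)), "we remove the terms near the diagonal. To do this smoothly we use
the function `g(x)` whose graph is" a trapezoid: `g = 1` on `[2S/(HR), 2S/R]`, supported on a slightly
larger interval, `1 ≤ H ≤ RS/D` ((12.7)); after flipping the modulus the weight is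
`B(x, y) = f(|x|y) g(|x|)` ((12.11)) and "we represent `B(x, y)` as the Fourier–Mellin transform in `x`
and `y` respectively, (12.13) `f(|x|y)g(|x|) = ∬ h(u,t) e(ux) y^{it} du dt` […] integrating the Fourier
transform by parts up to two times we get
`∫₀^∞ x^{it} g(x) cos(2πux) dx ≪ (t²+1) min{S/R, 1/|u|, HR/(u²S)} log 2H`.  From these estimates it
follows that the `L₁`-norm of `h(u,t)` satisfies (12.14) `∬ |h(u,t)| du dt ≪ (log 2H)²`."
The same device is used again in §16 ("we use the same technique as in Section 12", p. 54).

This file PROVES the `x`-side of the device (the `y`-side — the majorant `f` and its Mellin kernel,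
integrable against every power of `t` — is `exists_majorant_mellinKernel` in
`FriedlanderIwaniecPrimesSmoothMajorantMellinKernel`):

* `exists_smooth_cutoff` — for `0 < a ≤ b` a cutoff `g(x) = S(x/a - 1) S(3 - x/b)` (`S` Mathlib's
  `Real.smoothTransition`): `0 ≤ g ≤ 1`, `g = 1` on `[2a, 2b]`, `g = 0` off `(a, 3b)`, with its first
  two derivatives `g₁, g₂` vanishing off `[a,2a] ∪ [2b,3b]` and bounded by `c/a, c/a²` resp. `c/b, c/b²`
  there (`c` absolute) — so `∫|g'| ≤ 2c`, `∫|g''| ≤ 2c/a`, scale-invariantly.  (In FI: `a = S/(HR)`,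
  `b = S/R`, `b/a = H`.)
* `exists_cutoff_fourierKernel` — **the kernel**: an absolute `K` such that for all `0 < a ≤ b` and
  every real `t` there is an integrable `Ĝ_t` with
  `g(|x|) e^{2πi t log|x|} = ∫ Ĝ_t(u) e(ux) du` for ALL real `x`, and
  `∫ |Ĝ_t(u)| du ≤ K (1 + |t|)² (1 + log(b/a))²`.
  Route (the printed one): `G(x) = g(x)x^{2πit}` on `x > 0` has `‖G‖₁ ≤ 3b`,
  `‖G'‖₁ ≤ 2c + 2π|t| log(3b/a)`, `‖G''‖₁ ≤ C(1+|t|)²/a`; two integrations by parts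
  (`Real.fourier_deriv`) give `|Ĝ(u)| ≤ min{‖G‖₁, ‖G'‖₁/(2π|u|), ‖G''‖₁/(4π²u²)}`, and the three régimes
  `|u| ≤ 1/b`, `1/b < |u| ≤ 1/a`, `|u| > 1/a` integrate to `≪ (1+|t|)²(1 + log(b/a))²`; Fourier
  inversion (`Continuous.fourierInv_fourier_eq`) and the even extension `G(x) + G(-x)` give the
  representation.  With the `y`-side, `h(u,t) = M(t) D^{-2πit} Ĝ_t(u)` is the kernel of (12.13) and
  `∬|h| ≤ K (1+log H)² ∫ |M(t)|(1+|t|)² dt ≪ (log 2H)²` is (12.14).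

No definitions, no named facts.  (HOME/parity-ideate-lit/FI98-Prop121-MAP.md, step 6, `x`-side.)

## References
* J. Friedlander, H. Iwaniec, Ann. of Math. (2) 148 (1998) 945–1040, §12 (12.7), (12.11), (12.13),
  (12.14). [cite: FriedlanderIwaniecAnnals1998, §12 (12.13)–(12.14)]

## Mathlib
`Real.smoothTransition`, `Real.fourier_deriv` (Fourier transform of a derivative),
`VectorFourier.norm_fourierIntegral_le_integral_norm`, `VectorFourier.fourierIntegral_continuous`,
`Continuous.fourierInv_fourier_eq`, `Real.fourierInv_eq'`, `integral_neg_eq_self`, `integral_comp_abs`,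
`integral_inv_of_pos`, `integral_rpow`, `integral_Ioi_rpow_of_lt`, `integrable_inv_one_add_sq`.
-/

noncomputable section

open Real Complex MeasureTheory Set Filter
open scoped FourierTransform ContDiff Topology

namespace Literature.NumberTheory.Sieve.FriedlanderIwaniecPrimes

/-! ### The smooth step `S = Real.smoothTransition`: its first two derivatives vanish off `(0,1)`
and are bounded -/

/-- For `S = Real.smoothTransition`: `S'` and `S''` are continuous, bounded by a common constant
`c ≥ 0`, and vanish for `y ≤ 0` and for `y ≥ 1`; `S` is differentiable with `HasDerivAt S (S' y) y`
and `HasDerivAt S' (S'' y) y`. [folklore] -/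
private theorem smoothTransition_deriv_facts :
    ∃ c : ℝ, 0 ≤ c ∧ Continuous (deriv Real.smoothTransition) ∧
      Continuous (deriv (deriv Real.smoothTransition)) ∧
      (∀ y, HasDerivAt Real.smoothTransition (deriv Real.smoothTransition y) y) ∧
      (∀ y, HasDerivAt (deriv Real.smoothTransition) (deriv (deriv Real.smoothTransition) y) y) ∧
      (∀ y, |deriv Real.smoothTransition y| ≤ c) ∧
      (∀ y, |deriv (deriv Real.smoothTransition) y| ≤ c) ∧
      (∀ y, y ≤ 0 → deriv Real.smoothTransition y = 0 ∧ deriv (deriv Real.smoothTransition) y = 0) ∧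
      (∀ y, 1 ≤ y → deriv Real.smoothTransition y = 0 ∧ deriv (deriv Real.smoothTransition) y = 0) := by
  set S := Real.smoothTransition with hSdef
  have hS : ContDiff ℝ ∞ S := Real.smoothTransition.contDiff
  have h1 : ContDiff ℝ ∞ (deriv S) := hS.iterate_deriv 1
  have h2 : ContDiff ℝ ∞ (deriv (deriv S)) := hS.iterate_deriv 2
  have hd1 : ∀ y, HasDerivAt S (deriv S y) y := fun y =>
    ((hS.differentiable (by simp)).differentiableAt).hasDerivAt
  have hd2 : ∀ y, HasDerivAt (deriv S) (deriv (deriv S) y) y := fun y =>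
    ((h1.differentiable (by simp)).differentiableAt).hasDerivAt
  -- vanishing on the open pieces
  have hIio : ∀ y, y < 0 → deriv S y = 0 := fun y hy => by
    have : S =ᶠ[𝓝 y] fun _ => (0 : ℝ) :=
      Filter.eventually_of_mem (Iio_mem_nhds hy) fun w hw =>
        Real.smoothTransition.zero_of_nonpos (le_of_lt hw)
    rw [this.deriv_eq, deriv_const]
  have hIoi : ∀ y, 1 < y → deriv S y = 0 := fun y hy => by
    have : S =ᶠ[𝓝 y] fun _ => (1 : ℝ) :=
      Filter.eventually_of_mem (Ioi_mem_nhds hy) fun w hw =>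
        Real.smoothTransition.one_of_one_le (le_of_lt hw)
    rw [this.deriv_eq, deriv_const]
  have hIio2 : ∀ y, y < 0 → deriv (deriv S) y = 0 := fun y hy => by
    have : deriv S =ᶠ[𝓝 y] fun _ => (0 : ℝ) :=
      Filter.eventually_of_mem (Iio_mem_nhds hy) fun w hw => hIio w hw
    rw [this.deriv_eq, deriv_const]
  have hIoi2 : ∀ y, 1 < y → deriv (deriv S) y = 0 := fun y hy => by
    have : deriv S =ᶠ[𝓝 y] fun _ => (0 : ℝ) :=
      Filter.eventually_of_mem (Ioi_mem_nhds hy) fun w hw => hIoi w hw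
    rw [this.deriv_eq, deriv_const]
  -- closed pieces, by continuity
  have hclosed : ∀ (F : ℝ → ℝ), Continuous F → (∀ y, y < 0 → F y = 0) → (∀ y, 1 < y → F y = 0) →
      (∀ y, y ≤ 0 → F y = 0) ∧ (∀ y, 1 ≤ y → F y = 0) := by
    intro F hF hl hr
    have hZ : IsClosed {y : ℝ | F y = 0} := isClosed_eq hF continuous_const
    constructor
    · intro y hy
      have hsub : closure (Iio (0 : ℝ)) ⊆ {y : ℝ | F y = 0} :=
        hZ.closure_subset_iff.2 fun w hw => hl w hw
      exact hsub (by rw [closure_Iio]; exact hy)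
    · intro y hy
      have hsub : closure (Ioi (1 : ℝ)) ⊆ {y : ℝ | F y = 0} :=
        hZ.closure_subset_iff.2 fun w hw => hr w hw
      exact hsub (by rw [closure_Ioi]; exact hy)
  obtain ⟨hl1, hr1⟩ := hclosed _ h1.continuous hIio hIoi
  obtain ⟨hl2, hr2⟩ := hclosed _ h2.continuous hIio2 hIoi2
  -- boundedness: compact support ⊆ [0,1]
  have hsupp : ∀ (F : ℝ → ℝ), (∀ y, y ≤ 0 → F y = 0) → (∀ y, 1 ≤ y → F y = 0) →
      HasCompactSupport F := by
    intro F hl hr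
    refine HasCompactSupport.of_support_subset_isCompact (isCompact_Icc : IsCompact (Icc (0:ℝ) 1)) ?_
    intro y hy
    rw [Function.mem_support] at hy
    rw [mem_Icc]
    constructor
    · by_contra h; exact hy (hl y (le_of_lt (not_le.1 h)))
    · by_contra h; exact hy (hr y (le_of_lt (not_le.1 h)))
  obtain ⟨C₁, hC₁⟩ := h1.continuous.bounded_above_of_compact_support (hsupp _ hl1 hr1)
  obtain ⟨C₂, hC₂⟩ := h2.continuous.bounded_above_of_compact_support (hsupp _ hl2 hr2)
  refine ⟨max (max C₁ C₂) 0, le_max_right _ _, h1.continuous, h2.continuous, hd1, hd2,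
    fun y => ?_, fun y => ?_, fun y hy => ⟨hl1 y hy, hl2 y hy⟩, fun y hy => ⟨hr1 y hy, hr2 y hy⟩⟩
  · have := hC₁ y
    rw [Real.norm_eq_abs] at this
    exact this.trans ((le_max_left _ _).trans (le_max_left _ _))
  · have := hC₂ y
    rw [Real.norm_eq_abs] at this
    exact this.trans ((le_max_right _ _).trans (le_max_left _ _))

/-! ### The cutoff `g(x) = S(x/a − 1) S(3 − x/b)` and its first two derivatives -/

/-- **The smooth cutoff of (12.7)/(12.11).**  There is an absolute `c ≥ 0` such that for all
`0 < a ≤ b` there are `g, g₁, g₂ : ℝ → ℝ` (`g₁ = g'`, `g₂ = g''`) with: `0 ≤ g ≤ 1`, `g = 1` on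
`[2a, 2b]`, `g = 0` on `(-∞, a] ∪ [3b, ∞)`; `g₁, g₂` continuous, vanishing off `[a, 2a] ∪ [2b, 3b]`,
with `|g₁| ≤ c/a`, `|g₂| ≤ c/a²` on `[a, 2a]` and `|g₁| ≤ c/b`, `|g₂| ≤ c/b²` on `[2b, 3b]`
(so `∫|g₁| ≤ 2c`, `∫|g₂| ≤ 2c/a`: the scale-invariant bounds behind "integrating by parts up to two
times", FI p. 51). [cite: FriedlanderIwaniecAnnals1998, §12 (12.7), (12.11)] -/
theorem exists_smooth_cutoff :
    ∃ c : ℝ, 0 ≤ c ∧ ∀ (a b : ℝ), 0 < a → a ≤ b →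
      ∃ g g₁ g₂ : ℝ → ℝ, Continuous g ∧ Continuous g₁ ∧ Continuous g₂ ∧
        (∀ x, HasDerivAt g (g₁ x) x) ∧ (∀ x, HasDerivAt g₁ (g₂ x) x) ∧
        (∀ x, 0 ≤ g x) ∧ (∀ x, g x ≤ 1) ∧ (∀ x ∈ Icc (2 * a) (2 * b), g x = 1) ∧
        (∀ x, x ≤ a → g x = 0 ∧ g₁ x = 0 ∧ g₂ x = 0) ∧
        (∀ x, 3 * b ≤ x → g x = 0 ∧ g₁ x = 0 ∧ g₂ x = 0) ∧
        (∀ x, 2 * a ≤ x → x ≤ 2 * b → g₁ x = 0 ∧ g₂ x = 0) ∧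
        (∀ x, x ≤ 2 * a → |g₁ x| ≤ c / a ∧ |g₂ x| ≤ c / a ^ 2) ∧
        (∀ x, 2 * b ≤ x → |g₁ x| ≤ c / b ∧ |g₂ x| ≤ c / b ^ 2) := by
  obtain ⟨c, hc0, hS1c, hS2c, hd1, hd2, hB1, hB2, hle0, hge1⟩ := smoothTransition_deriv_facts
  set S := Real.smoothTransition with hSdef
  refine ⟨c + c ^ 2 + c, by positivity, fun a b ha hab => ?_⟩
  have hb : 0 < b := ha.trans_le hab
  -- the three functions
  set g : ℝ → ℝ := fun x => S (x / a - 1) * S (3 - x / b) with hg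
  set g₁ : ℝ → ℝ := fun x =>
    deriv S (x / a - 1) * (1 / a) * S (3 - x / b) + S (x / a - 1) * (deriv S (3 - x / b) * -(1 / b))
    with hg₁
  set g₂ : ℝ → ℝ := fun x =>
    deriv (deriv S) (x / a - 1) * (1 / a) * (1 / a) * S (3 - x / b) +
        deriv S (x / a - 1) * (1 / a) * (deriv S (3 - x / b) * -(1 / b)) +
      (deriv S (x / a - 1) * (1 / a) * (deriv S (3 - x / b) * -(1 / b)) +
        S (x / a - 1) * (deriv (deriv S) (3 - x / b) * -(1 / b) * -(1 / b))) with hg₂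
  -- derivatives of the inner maps
  have hinA : ∀ x, HasDerivAt (fun x : ℝ => x / a - 1) (1 / a) x := fun x => by
    simpa using ((hasDerivAt_id x).div_const a).sub_const 1
  have hinB : ∀ x, HasDerivAt (fun x : ℝ => 3 - x / b) (-(1 / b)) x := fun x => by
    simpa using ((hasDerivAt_id x).div_const b).const_sub 3
  have hA : ∀ x, HasDerivAt (fun x => S (x / a - 1)) (deriv S (x / a - 1) * (1 / a)) x := fun x => by
    have := (hd1 (x / a - 1)).comp x (hinA x)
    simpa only [Function.comp_def] using this
  have hB : ∀ x, HasDerivAt (fun x => S (3 - x / b)) (deriv S (3 - x / b) * -(1 / b)) x := fun x => by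
    have := (hd1 (3 - x / b)).comp x (hinB x)
    simpa only [Function.comp_def] using this
  have hA' : ∀ x, HasDerivAt (fun x => deriv S (x / a - 1) * (1 / a))
      (deriv (deriv S) (x / a - 1) * (1 / a) * (1 / a)) x := fun x => by
    have := ((hd2 (x / a - 1)).comp x (hinA x)).mul_const (1 / a)
    simpa only [Function.comp_def] using this
  have hB' : ∀ x, HasDerivAt (fun x => deriv S (3 - x / b) * -(1 / b))
      (deriv (deriv S) (3 - x / b) * -(1 / b) * -(1 / b)) x := fun x => by
    have := ((hd2 (3 - x / b)).comp x (hinB x)).mul_const (-(1 / b))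
    simpa only [Function.comp_def] using this
  have hgd : ∀ x, HasDerivAt g (g₁ x) x := fun x => (hA x).mul (hB x)
  have hg₁d : ∀ x, HasDerivAt g₁ (g₂ x) x := fun x =>
    ((hA' x).mul (hB x)).add ((hA x).mul (hB' x))
  -- continuity
  have hcS : Continuous S := Real.smoothTransition.continuous
  have hcA : Continuous fun x : ℝ => x / a - 1 := by fun_prop
  have hcB : Continuous fun x : ℝ => 3 - x / b := by fun_prop
  have hgc : Continuous g := (hcS.comp hcA).mul (hcS.comp hcB)
  have hg₁c : Continuous g₁ :=
    (((hS1c.comp hcA).mul continuous_const).mul (hcS.comp hcB)).add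
      ((hcS.comp hcA).mul ((hS1c.comp hcB).mul continuous_const))
  have hg₂c : Continuous g₂ := by
    refine Continuous.add (Continuous.add ?_ ?_) (Continuous.add ?_ ?_)
    · exact (((hS2c.comp hcA).mul continuous_const).mul continuous_const).mul (hcS.comp hcB)
    · exact ((hS1c.comp hcA).mul continuous_const).mul ((hS1c.comp hcB).mul continuous_const)
    · exact ((hS1c.comp hcA).mul continuous_const).mul ((hS1c.comp hcB).mul continuous_const)
    · exact (hcS.comp hcA).mul (((hS2c.comp hcB).mul continuous_const).mul continuous_const)
  refine ⟨g, g₁, g₂, hgc, hg₁c, hg₂c, hgd, hg₁d, fun x => ?_, fun x => ?_, fun x hx => ?_,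
    fun x hx => ?_, fun x hx => ?_, fun x h1 h2 => ?_, fun x hx => ?_, fun x hx => ?_⟩
  · exact mul_nonneg (Real.smoothTransition.nonneg _) (Real.smoothTransition.nonneg _)
  · exact mul_le_one₀ (Real.smoothTransition.le_one _) (Real.smoothTransition.nonneg _)
      (Real.smoothTransition.le_one _)
  · -- `g = 1` on `[2a, 2b]`
    rw [mem_Icc] at hx
    have h1 : 1 ≤ x / a - 1 := by rw [le_sub_iff_add_le, le_div_iff₀ ha]; linarith
    have h2 : 1 ≤ 3 - x / b := by
      have : x / b ≤ 2 := by rw [div_le_iff₀ hb]; linarith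
      linarith
    have e1 : S (x / a - 1) = 1 := Real.smoothTransition.one_of_one_le h1
    have e2 : S (3 - x / b) = 1 := Real.smoothTransition.one_of_one_le h2
    simp only [hg, e1, e2, mul_one]
  · -- `x ≤ a`: the `S(x/a-1)`-factors and their derivatives vanish
    have h1 : x / a - 1 ≤ 0 := by rw [sub_nonpos, div_le_one ha]; exact hx
    have e0 : S (x / a - 1) = 0 := Real.smoothTransition.zero_of_nonpos h1
    have e1 : deriv S (x / a - 1) = 0 := (hle0 _ h1).1
    have e2 : deriv (deriv S) (x / a - 1) = 0 := (hle0 _ h1).2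
    simp only [hg, hg₁, hg₂, e0, e1, e2, zero_mul, add_zero, and_self]
  · -- `3b ≤ x`: the `S(3 - x/b)`-factors vanish
    have h1 : 3 - x / b ≤ 0 := by
      have : 3 ≤ x / b := by rw [le_div_iff₀ hb]; linarith
      linarith
    have e0 : S (3 - x / b) = 0 := Real.smoothTransition.zero_of_nonpos h1
    have e1 : deriv S (3 - x / b) = 0 := (hle0 _ h1).1
    have e2 : deriv (deriv S) (3 - x / b) = 0 := (hle0 _ h1).2
    simp only [hg, hg₁, hg₂, e0, e1, e2, zero_mul, mul_zero, add_zero, and_self]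
  · -- `2a ≤ x ≤ 2b`: all derivative factors vanish
    have ha1 : 1 ≤ x / a - 1 := by rw [le_sub_iff_add_le, le_div_iff₀ ha]; linarith
    have hb1 : 1 ≤ 3 - x / b := by
      have : x / b ≤ 2 := by rw [div_le_iff₀ hb]; linarith
      linarith
    have e1 : deriv S (x / a - 1) = 0 := (hge1 _ ha1).1
    have e2 : deriv (deriv S) (x / a - 1) = 0 := (hge1 _ ha1).2
    have e3 : deriv S (3 - x / b) = 0 := (hge1 _ hb1).1
    have e4 : deriv (deriv S) (3 - x / b) = 0 := (hge1 _ hb1).2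
    simp only [hg₁, hg₂, e1, e2, e3, e4, zero_mul, mul_zero, add_zero, and_self]
  · -- `x ≤ 2a (≤ 2b)`: the `S(3 - x/b)`-derivatives vanish; bounds `c/a`, `c/a²`
    have hb1 : 1 ≤ 3 - x / b := by
      have : x / b ≤ 2 := by rw [div_le_iff₀ hb]; linarith
      linarith
    have e3 : deriv S (3 - x / b) = 0 := (hge1 _ hb1).1
    have e4 : deriv (deriv S) (3 - x / b) = 0 := (hge1 _ hb1).2
    have hS0 : |S (3 - x / b)| ≤ 1 := by
      rw [abs_of_nonneg (Real.smoothTransition.nonneg _)]; exact Real.smoothTransition.le_one _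
    constructor
    · simp only [hg₁, e3, zero_mul, mul_zero, add_zero]
      rw [abs_mul, abs_mul, abs_of_pos (by positivity : (0:ℝ) < 1 / a)]
      calc |deriv S (x / a - 1)| * (1 / a) * |S (3 - x / b)|
          ≤ c * (1 / a) * 1 := by gcongr; exact hB1 _
        _ ≤ (c + c ^ 2 + c) / a := by
            rw [mul_one, mul_one_div, div_le_div_iff_of_pos_right ha]; nlinarith
    · simp only [hg₂, e3, e4, zero_mul, mul_zero, add_zero]
      rw [abs_mul, abs_mul, abs_mul, abs_of_pos (by positivity : (0:ℝ) < 1 / a)]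
      calc |deriv (deriv S) (x / a - 1)| * (1 / a) * (1 / a) * |S (3 - x / b)|
          ≤ c * (1 / a) * (1 / a) * 1 := by gcongr; exact hB2 _
        _ ≤ (c + c ^ 2 + c) / a ^ 2 := by
            rw [mul_one, show c * (1 / a) * (1 / a) = c / a ^ 2 by field_simp,
              div_le_div_iff_of_pos_right (by positivity)]; nlinarith
  · -- `2b ≤ x (≥ 2a)`: the `S(x/a - 1)`-derivatives vanish; bounds `c/b`, `c/b²`
    have ha1 : 1 ≤ x / a - 1 := by
      rw [le_sub_iff_add_le, le_div_iff₀ ha]; nlinarith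
    have e1 : deriv S (x / a - 1) = 0 := (hge1 _ ha1).1
    have e2 : deriv (deriv S) (x / a - 1) = 0 := (hge1 _ ha1).2
    have hS0 : |S (x / a - 1)| ≤ 1 := by
      rw [abs_of_nonneg (Real.smoothTransition.nonneg _)]; exact Real.smoothTransition.le_one _
    constructor
    · simp only [hg₁, e1, zero_mul, zero_add]
      rw [abs_mul, abs_mul, abs_neg, abs_of_pos (by positivity : (0:ℝ) < 1 / b)]
      calc |S (x / a - 1)| * (|deriv S (3 - x / b)| * (1 / b))
          ≤ 1 * (c * (1 / b)) := by gcongr; exact hB1 _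
        _ ≤ (c + c ^ 2 + c) / b := by
            rw [one_mul, mul_one_div, div_le_div_iff_of_pos_right hb]; nlinarith
    · simp only [hg₂, e1, e2, zero_mul, zero_add]
      rw [abs_mul, abs_mul, abs_mul, abs_neg, abs_of_pos (by positivity : (0:ℝ) < 1 / b)]
      calc |S (x / a - 1)| * (|deriv (deriv S) (3 - x / b)| * (1 / b) * (1 / b))
          ≤ 1 * (c * (1 / b) * (1 / b)) := by gcongr; exact hB2 _
        _ ≤ (c + c ^ 2 + c) / b ^ 2 := by
            rw [one_mul, show c * (1 / b) * (1 / b) = c / b ^ 2 by field_simp,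
              div_le_div_iff_of_pos_right (by positivity)]; nlinarith


/-! ### Generic Fourier decay from two derivatives ("integrating by parts up to two times") -/

/-- `‖𝓕 f(u)‖ ≤ ‖f‖₁`. [folklore] -/
private theorem fourier_norm_le_l1 (f : ℝ → ℂ) (u : ℝ) : ‖𝓕 f u‖ ≤ ∫ x, ‖f x‖ :=
  VectorFourier.norm_fourierIntegral_le_integral_norm _ _ _ f u

/-- Two integrations by parts: if `f → f₁ → f₂` is a chain of derivatives of integrable functions,
then `‖𝓕f(u)‖ ≤ ‖f‖₁`, `2π|u| ‖𝓕f(u)‖ ≤ ‖f₁‖₁` and `4π²u² ‖𝓕f(u)‖ ≤ ‖f₂‖₁`. [folklore] -/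
private theorem fourier_decay_of_two_derivs {f f₁ f₂ : ℝ → ℂ} (hf : Integrable f)
    (hf₁ : Integrable f₁) (hf₂ : Integrable f₂) (hd : ∀ x, HasDerivAt f (f₁ x) x)
    (hd₁ : ∀ x, HasDerivAt f₁ (f₂ x) x) (u : ℝ) :
    ‖𝓕 f u‖ ≤ (∫ x, ‖f x‖) ∧ 2 * π * |u| * ‖𝓕 f u‖ ≤ (∫ x, ‖f₁ x‖) ∧
      4 * π ^ 2 * u ^ 2 * ‖𝓕 f u‖ ≤ ∫ x, ‖f₂ x‖ := by
  have hdf : deriv f = f₁ := deriv_eq hd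
  have hdf₁ : deriv f₁ = f₂ := deriv_eq hd₁
  have hdiff : Differentiable ℝ f := fun x => (hd x).differentiableAt
  have hdiff₁ : Differentiable ℝ f₁ := fun x => (hd₁ x).differentiableAt
  have h1 : 𝓕 f₁ u = (2 * π * I * u) • 𝓕 f u := by
    have := Real.fourier_deriv hf hdiff (hdf ▸ hf₁)
    rw [hdf] at this
    exact congrFun this u
  have h2 : 𝓕 f₂ u = (2 * π * I * u) • 𝓕 f₁ u := by
    have := Real.fourier_deriv hf₁ hdiff₁ (hdf₁ ▸ hf₂)
    rw [hdf₁] at this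
    exact congrFun this u
  have hn : ‖(2 * π * I * u : ℂ)‖ = 2 * π * |u| := by
    simp [abs_of_pos Real.pi_pos]
  have e1 : ‖𝓕 f₁ u‖ = 2 * π * |u| * ‖𝓕 f u‖ := by rw [h1, norm_smul, hn]
  have e2 : ‖𝓕 f₂ u‖ = 4 * π ^ 2 * u ^ 2 * ‖𝓕 f u‖ := by
    rw [h2, norm_smul, hn, e1, ← sq_abs u]; ring
  exact ⟨fourier_norm_le_l1 f u, e1 ▸ fourier_norm_le_l1 f₁ u,
    e2 ▸ fourier_norm_le_l1 f₂ u⟩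

/-! ### The three-régime bound `∫ min{A₀, A₁/|u|, A₂/u²} du ≤ 2(A₀/b + A₁ log(b/a) + A₂ a)` -/

/-- If `‖φ(u)‖ ≤ A₀`, `|u|‖φ(u)‖ ≤ A₁`, `u²‖φ(u)‖ ≤ A₂` and `φ` is continuous, then for `0 < a ≤ b`
(use `A₀` on `|u| ≤ 1/b`, `A₁/|u|` on `1/b < |u| ≤ 1/a`, `A₂/u²` beyond): `φ ∈ L¹` and
`∫‖φ‖ ≤ 2(A₀/b + A₁ log(b/a) + A₂ a)`. [folklore] -/
private theorem integral_norm_le_of_decay {φ : ℝ → ℂ} (hφ : Continuous φ) {A₀ A₁ A₂ a b : ℝ}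
    (hA₀ : 0 ≤ A₀) (hA₁ : 0 ≤ A₁) (hA₂ : 0 ≤ A₂) (ha : 0 < a) (hab : a ≤ b)
    (h0 : ∀ u, ‖φ u‖ ≤ A₀) (h1 : ∀ u, |u| * ‖φ u‖ ≤ A₁) (h2 : ∀ u, u ^ 2 * ‖φ u‖ ≤ A₂) :
    Integrable φ ∧ ∫ u, ‖φ u‖ ≤ 2 * (A₀ / b + A₁ * Real.log (b / a) + A₂ * a) := by
  have hb : 0 < b := ha.trans_le hab
  have hba : 1 / b ≤ 1 / a := one_div_le_one_div_of_le ha hab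
  -- the majorant on `[0, ∞)` and its even extension
  set n : ℝ → ℝ := fun v =>
    if v ≤ 1 / b then A₀ else if v ≤ 1 / a then A₁ * v⁻¹ else A₂ * (v ^ 2)⁻¹ with hn
  set m : ℝ → ℝ := fun u => n |u| with hm
  -- pointwise domination
  have hdom : ∀ u, ‖φ u‖ ≤ m u := by
    intro u
    simp only [hm, hn]
    split_ifs with hu1 hu2
    · exact h0 u
    · -- `1/b < |u|`: `‖φ u‖ ≤ A₁/|u|`
      have hu : 0 < |u| := lt_of_le_of_lt (by positivity) (not_le.1 hu1)
      rw [← div_eq_mul_inv, le_div_iff₀ hu, mul_comm]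
      exact h1 u
    · have hu : 0 < |u| := lt_of_le_of_lt (by positivity) (not_le.1 hu1)
      have hu2' : 0 < |u| ^ 2 := by positivity
      rw [← div_eq_mul_inv, le_div_iff₀ hu2', mul_comm, sq_abs]
      exact h2 u
  -- a crude integrable majorant of `m`: `K (1 + u²)⁻¹`
  set K : ℝ := (A₀ + A₁ * b) * (1 + 1 / a ^ 2) + A₂ * (1 + a ^ 2) with hK
  have hmK : ∀ u, m u ≤ K * (1 + u ^ 2)⁻¹ := by
    intro u
    have hu2 : 0 < 1 + u ^ 2 := by positivity
    rw [← div_eq_mul_inv, le_div_iff₀ hu2]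
    simp only [hm, hn, sq_abs]
    have hK1 : 0 ≤ (A₀ + A₁ * b) * (1 + 1 / a ^ 2) := by positivity
    have hK2 : 0 ≤ A₂ * (1 + a ^ 2) := by positivity
    split_ifs with hu1 hu2'
    · -- `|u| ≤ 1/b ≤ 1/a`
      have : u ^ 2 ≤ 1 / a ^ 2 := by
        rw [← sq_abs, one_div, ← inv_pow]
        exact pow_le_pow_left₀ (abs_nonneg u) (hu1.trans (hba.trans_eq (one_div a))) 2
      nlinarith [mul_nonneg hA₁ hb.le]
    · -- `1/b < |u| ≤ 1/a`: `A₁/|u| ≤ A₁ b`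
      have hu : 0 < |u| := lt_of_le_of_lt (by positivity) (not_le.1 hu1)
      have hinv : |u|⁻¹ ≤ b := by
        rw [inv_le_comm₀ hu hb, ← one_div]; exact (not_le.1 hu1).le
      have : u ^ 2 ≤ 1 / a ^ 2 := by
        rw [← sq_abs, one_div, ← inv_pow]
        exact pow_le_pow_left₀ (abs_nonneg u) (hu2'.trans_eq (one_div a)) 2
      have h3 : A₁ * |u|⁻¹ ≤ A₁ * b := mul_le_mul_of_nonneg_left hinv hA₁
      nlinarith [mul_nonneg hA₁ hb.le, mul_nonneg (mul_nonneg hA₁ hb.le) (sq_nonneg u)]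
    · -- `1/a < |u|`: `A₂/u² ≤ A₂(1+a²)/(1+u²)`
      have hu : 1 / a < |u| := not_le.1 hu2'
      have hau : 1 ≤ a ^ 2 * u ^ 2 := by
        have : 1 < a * |u| := by rwa [div_lt_iff₀' ha] at hu
        nlinarith [sq_abs u, this]
      have hu0 : 0 < u ^ 2 := by
        have hupos : 0 < |u| := lt_trans (by positivity) hu
        rw [← sq_abs]; exact pow_pos hupos 2
      rw [show A₂ * (u ^ 2)⁻¹ * (1 + u ^ 2) = A₂ * ((1 + u ^ 2) / u ^ 2) by ring]
      have : (1 + u ^ 2) / u ^ 2 ≤ 1 + a ^ 2 := by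
        rw [div_le_iff₀ hu0]; nlinarith
      nlinarith [mul_le_mul_of_nonneg_left this hA₂]
  -- measurability of `m`
  have hn_meas : Measurable n := by
    refine Measurable.ite (measurableSet_le measurable_id measurable_const) measurable_const ?_
    refine Measurable.ite (measurableSet_le measurable_id measurable_const) ?_ ?_
    · exact measurable_const.mul measurable_inv
    · exact measurable_const.mul ((measurable_id.pow_const 2).inv)
  have hm_meas : Measurable m := hn_meas.comp measurable_abs
  have hm0 : ∀ u, 0 ≤ m u := fun u => (norm_nonneg _).trans (hdom u)
  have hm_int : Integrable m := by
    refine Integrable.mono' (integrable_inv_one_add_sq.const_mul K) hm_meas.aestronglyMeasurable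
      (Eventually.of_forall fun u => ?_)
    rw [Real.norm_eq_abs, abs_of_nonneg (hm0 u)]
    exact hmK u
  have hφ_int : Integrable φ :=
    Integrable.mono' hm_int hφ.aestronglyMeasurable (Eventually.of_forall hdom)
  refine ⟨hφ_int, ?_⟩
  -- `∫‖φ‖ ≤ ∫ m = 2 ∫_{v>0} n(v)`
  have hle : ∫ u, ‖φ u‖ ≤ ∫ u, m u :=
    integral_mono hφ_int.norm hm_int hdom
  refine hle.trans ?_
  rw [hm, integral_comp_abs]
  -- `∫_{v>0} n = A₀/b + A₁ log(b/a) + A₂ a`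
  have hEq1 : EqOn n (fun _ => A₀) (Ioc 0 (1 / b)) := fun v hv => by
    rw [mem_Ioc] at hv; simp only [hn, if_pos hv.2]
  have hEq2 : EqOn n (fun v => A₁ * v⁻¹) (Ioc (1 / b) (1 / a)) := fun v hv => by
    rw [mem_Ioc] at hv; simp only [hn, if_neg (not_le.2 hv.1), if_pos hv.2]
  have hEq3 : EqOn n (fun v => A₂ * v ^ (-2 : ℝ)) (Ioi (1 / a)) := fun v hv => by
    rw [mem_Ioi] at hv
    have hv0 : 0 < v := lt_trans (by positivity) hv
    simp only [hn, if_neg (not_le.2 (lt_of_le_of_lt hba hv)), if_neg (not_le.2 hv)]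
    rw [Real.rpow_neg hv0.le, show (2 : ℝ) = (2 : ℕ) by norm_num, Real.rpow_natCast]
  have hI1 : IntegrableOn n (Ioc 0 (1 / b)) := by
    have h : IntegrableOn (fun _ : ℝ => A₀) (Ioc 0 (1 / b)) :=
      integrableOn_const (hs := by rw [Real.volume_Ioc]; exact ENNReal.ofReal_ne_top)
    exact h.congr_fun hEq1.symm measurableSet_Ioc
  have hI2 : IntegrableOn n (Ioc (1 / b) (1 / a)) := by
    have hcont : ContinuousOn (fun v : ℝ => A₁ * v⁻¹) (Icc (1 / b) (1 / a)) := by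
      refine continuousOn_const.mul (continuousOn_inv₀.mono ?_)
      intro v hv; rw [mem_Icc] at hv; exact (lt_of_lt_of_le (by positivity) hv.1).ne'
    exact ((hcont.integrableOn_Icc).mono_set Ioc_subset_Icc_self).congr_fun hEq2.symm
      measurableSet_Ioc
  have hI3 : IntegrableOn n (Ioi (1 / a)) := by
    have h : IntegrableOn (fun v : ℝ => A₂ * v ^ (-2 : ℝ)) (Ioi (1 / a)) :=
      Integrable.const_mul (integrableOn_Ioi_rpow_of_lt (by norm_num : (-2 : ℝ) < -1)
        (by positivity : (0:ℝ) < 1 / a)) A₂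
    exact h.congr_fun hEq3.symm measurableSet_Ioi
  have hsplit : ∫ v in Ioi (0 : ℝ), n v =
      (∫ v in Ioc 0 (1 / b), n v) + (∫ v in Ioc (1 / b) (1 / a), n v) + ∫ v in Ioi (1 / a), n v := by
    have e1 : Ioi (0 : ℝ) = (Ioc 0 (1 / b) ∪ Ioc (1 / b) (1 / a)) ∪ Ioi (1 / a) := by
      rw [Ioc_union_Ioc_eq_Ioc (by positivity) hba, Ioc_union_Ioi_eq_Ioi (by positivity)]
    rw [e1, setIntegral_union _ measurableSet_Ioi (hI1.union hI2) hI3,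
      setIntegral_union _ measurableSet_Ioc hI1 hI2]
    · exact Ioc_disjoint_Ioc_of_le le_rfl
    · rw [Ioc_union_Ioc_eq_Ioc (by positivity) hba]
      exact disjoint_left.2 fun v hv hv' => by
        rw [mem_Ioc] at hv; rw [mem_Ioi] at hv'; linarith
  have hJ1 : ∫ v in Ioc 0 (1 / b), n v = A₀ / b := by
    rw [setIntegral_congr_fun measurableSet_Ioc hEq1, setIntegral_const,
      Real.volume_real_Ioc_of_le (by positivity), sub_zero, smul_eq_mul]
    ring
  have hJ2 : ∫ v in Ioc (1 / b) (1 / a), n v = A₁ * Real.log (b / a) := by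
    rw [setIntegral_congr_fun measurableSet_Ioc hEq2, ← intervalIntegral.integral_of_le hba,
      intervalIntegral.integral_const_mul, integral_inv_of_pos (by positivity) (by positivity)]
    congr 1
    rw [div_div_div_comm, div_one, one_div_div]
  have hJ3 : ∫ v in Ioi (1 / a), n v = A₂ * a := by
    rw [setIntegral_congr_fun measurableSet_Ioi hEq3, integral_const_mul,
      integral_Ioi_rpow_of_lt (by norm_num) (by positivity)]
    have : (1 / a : ℝ) ^ ((-2 : ℝ) + 1) = a := by
      rw [show (-2 : ℝ) + 1 = -1 by norm_num, Real.rpow_neg_one, one_div, inv_inv]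
    rw [this]; ring
  rw [hsplit, hJ1, hJ2, hJ3]


/-! ### The twisted cutoff `G(x) = g(x) x^{2πit}` and its first two derivatives -/

/-- `‖exp(2πi t log x)‖ = 1`. [folklore] -/
private theorem norm_cexp_twist (t x : ℝ) :
    ‖Complex.exp (2 * π * I * t * (Real.log x : ℝ))‖ = 1 := by
  rw [show (2 * π * I * t * (Real.log x : ℝ) : ℂ) = ((2 * π * t * Real.log x : ℝ) : ℂ) * I by
    push_cast; ring]
  exact Complex.norm_exp_ofReal_mul_I _

/-- For a chain of derivatives `g → g₁ → g₂` of real functions vanishing on `(-∞, a]`, `a > 0`, and a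
real `t`: `G(x) = g(x) e^{2πi t log x}` has derivatives `G₁`, `G₂` (explicit), all three vanish where
`g, g₁, g₂` do, and `‖G‖ = |g|`, `‖G₁‖ ≤ |g₁| + 2π|t| |g|/x`,
`‖G₂‖ ≤ |g₂| + 4π|t| |g₁|/x + (4π²t² + 2π|t|)|g|/x²`. [folklore] -/
private theorem twist_derivs {g g₁ g₂ : ℝ → ℝ} {a : ℝ} (ha : 0 < a)
    (hd : ∀ x, HasDerivAt g (g₁ x) x) (hd₁ : ∀ x, HasDerivAt g₁ (g₂ x) x) (hg₂c : Continuous g₂)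
    (hz : ∀ x, x ≤ a → g x = 0 ∧ g₁ x = 0 ∧ g₂ x = 0) (t : ℝ) :
    ∃ G G₁ G₂ : ℝ → ℂ,
      (∀ x, G x = (g x : ℂ) * Complex.exp (2 * π * I * t * (Real.log x : ℝ))) ∧
      (∀ x, HasDerivAt G (G₁ x) x) ∧ (∀ x, HasDerivAt G₁ (G₂ x) x) ∧ Measurable G₂ ∧
      (∀ x, ‖G x‖ = |g x|) ∧
      (∀ x, ‖G₁ x‖ ≤ |g₁ x| + 2 * π * |t| * |g x| * x⁻¹) ∧
      (∀ x, ‖G₂ x‖ ≤ |g₂ x| + 4 * π * |t| * |g₁ x| * x⁻¹ +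
        (4 * π ^ 2 * t ^ 2 + 2 * π * |t|) * |g x| * (x ^ 2)⁻¹) ∧
      (∀ x, g x = 0 → g₁ x = 0 → g₂ x = 0 → G x = 0 ∧ G₁ x = 0 ∧ G₂ x = 0) := by
  -- the phase, its derivative data
  set k : ℂ := 2 * π * I * t with hk
  set E : ℝ → ℂ := fun x => Complex.exp (2 * π * I * t * (Real.log x : ℝ)) with hE
  set E₁ : ℝ → ℂ := fun x => E x * (k * ((x⁻¹ : ℝ) : ℂ)) with hE₁
  set E₂ : ℝ → ℂ := fun x => E₁ x * (k * ((x⁻¹ : ℝ) : ℂ)) + E x * (k * ((-(x ^ 2)⁻¹ : ℝ) : ℂ))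
    with hE₂
  have hEd : ∀ x, x ≠ 0 → HasDerivAt E (E₁ x) x := by
    intro x hx
    have hl : HasDerivAt (fun y : ℝ => ((Real.log y : ℝ) : ℂ)) ((x⁻¹ : ℝ) : ℂ) x :=
      (Real.hasDerivAt_log hx).ofReal_comp
    have hin : HasDerivAt (fun y : ℝ => k * ((Real.log y : ℝ) : ℂ)) (k * ((x⁻¹ : ℝ) : ℂ)) x :=
      hl.const_mul k
    have := hin.cexp
    simp only [hE, hE₁, hk] at this ⊢
    convert this using 2
  have hE₁d : ∀ x, x ≠ 0 → HasDerivAt E₁ (E₂ x) x := by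
    intro x hx
    have hi : HasDerivAt (fun y : ℝ => ((y⁻¹ : ℝ) : ℂ)) ((-(x ^ 2)⁻¹ : ℝ) : ℂ) x :=
      (hasDerivAt_inv hx).ofReal_comp
    have := (hEd x hx).mul (hi.const_mul k)
    exact this
  have hkn : ‖k‖ = 2 * π * |t| := by
    simp [hk, abs_of_pos Real.pi_pos]
  have hEn : ∀ x, ‖E x‖ = 1 := fun x => norm_cexp_twist t x
  -- the three functions
  set G : ℝ → ℂ := fun x => (g x : ℂ) * E x with hG
  set G₁ : ℝ → ℂ := fun x => (g₁ x : ℂ) * E x + (g x : ℂ) * E₁ x with hG₁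
  set G₂ : ℝ → ℂ := fun x =>
    (g₂ x : ℂ) * E x + (g₁ x : ℂ) * E₁ x + ((g₁ x : ℂ) * E₁ x + (g x : ℂ) * E₂ x) with hG₂
  have hvan : ∀ x, g x = 0 → g₁ x = 0 → g₂ x = 0 → G x = 0 ∧ G₁ x = 0 ∧ G₂ x = 0 := by
    intro x h0 h1 h2
    simp only [hG, hG₁, hG₂, h0, h1, h2, Complex.ofReal_zero, zero_mul, add_zero, and_self]
  -- derivatives
  have hGd : ∀ x, HasDerivAt G (G₁ x) x := by
    intro x
    rcases lt_or_ge x a with hx | hx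
    · -- locally zero
      have hev : G =ᶠ[𝓝 x] fun _ => (0 : ℂ) :=
        Filter.eventually_of_mem (Iio_mem_nhds hx) fun y hy =>
          (hvan y (hz y (le_of_lt hy)).1 (hz y (le_of_lt hy)).2.1 (hz y (le_of_lt hy)).2.2).1
      have h0 : G₁ x = 0 := (hvan x (hz x hx.le).1 (hz x hx.le).2.1 (hz x hx.le).2.2).2.1
      rw [h0]
      exact (hasDerivAt_const x (0 : ℂ)).congr_of_eventuallyEq hev
    · have hx0 : x ≠ 0 := (ha.trans_le hx).ne'
      exact ((hd x).ofReal_comp.mul (hEd x hx0))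
  have hG₁d : ∀ x, HasDerivAt G₁ (G₂ x) x := by
    intro x
    rcases lt_or_ge x a with hx | hx
    · have hev : G₁ =ᶠ[𝓝 x] fun _ => (0 : ℂ) :=
        Filter.eventually_of_mem (Iio_mem_nhds hx) fun y hy =>
          (hvan y (hz y (le_of_lt hy)).1 (hz y (le_of_lt hy)).2.1 (hz y (le_of_lt hy)).2.2).2.1
      have h0 : G₂ x = 0 := (hvan x (hz x hx.le).1 (hz x hx.le).2.1 (hz x hx.le).2.2).2.2
      rw [h0]
      exact (hasDerivAt_const x (0 : ℂ)).congr_of_eventuallyEq hev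
    · have hx0 : x ≠ 0 := (ha.trans_le hx).ne'
      exact ((hd₁ x).ofReal_comp.mul (hEd x hx0)).add ((hd x).ofReal_comp.mul (hE₁d x hx0))
  -- measurability of `G₂`
  have hgm : Measurable g := (fun x => (hd x).differentiableAt.continuousAt) |>
    continuous_iff_continuousAt.2 |>.measurable
  have hg₁m : Measurable g₁ := (fun x => (hd₁ x).differentiableAt.continuousAt) |>
    continuous_iff_continuousAt.2 |>.measurable
  have hg₂m : Measurable g₂ := hg₂c.measurable
  have hEm : Measurable E := by
    simp only [hE]
    exact Complex.measurable_exp.comp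
      (measurable_const.mul (Complex.measurable_ofReal.comp Real.measurable_log))
  have hinvm : Measurable fun x : ℝ => ((x⁻¹ : ℝ) : ℂ) :=
    Complex.measurable_ofReal.comp measurable_inv
  have hE₁m : Measurable E₁ := hEm.mul (measurable_const.mul hinvm)
  have hE₂m : Measurable E₂ := by
    refine (hE₁m.mul (measurable_const.mul hinvm)).add (hEm.mul (measurable_const.mul ?_))
    exact Complex.measurable_ofReal.comp ((measurable_id.pow_const 2).inv.neg)
  have hG₂m : Measurable G₂ := by
    simp only [hG₂]
    exact (((Complex.measurable_ofReal.comp hg₂m).mul hEm).add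
      ((Complex.measurable_ofReal.comp hg₁m).mul hE₁m)).add
      (((Complex.measurable_ofReal.comp hg₁m).mul hE₁m).add
        ((Complex.measurable_ofReal.comp hgm).mul hE₂m))
  -- norms
  have hGn : ∀ x, ‖G x‖ = |g x| := fun x => by
    simp only [hG, norm_mul, Complex.norm_real, Real.norm_eq_abs, hEn, mul_one]
  have hE₁n : ∀ x, 0 < x → ‖E₁ x‖ = 2 * π * |t| * x⁻¹ := fun x hx => by
    simp only [hE₁, norm_mul, hEn, hkn, one_mul, Complex.norm_real, Real.norm_eq_abs,
      abs_of_pos (inv_pos.2 hx)]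
  have hkr : ∀ r : ℝ, ‖k * (r : ℂ)‖ = 2 * π * |t| * |r| := fun r => by
    rw [norm_mul, hkn, Complex.norm_real, Real.norm_eq_abs]
  have hE₂n : ∀ x, 0 < x → ‖E₂ x‖ ≤ (4 * π ^ 2 * t ^ 2 + 2 * π * |t|) * (x ^ 2)⁻¹ := by
    intro x hx
    have hx2 : 0 < x ^ 2 := by positivity
    calc ‖E₂ x‖ ≤ ‖E₁ x * (k * ((x⁻¹ : ℝ) : ℂ))‖ + ‖E x * (k * ((-(x ^ 2)⁻¹ : ℝ) : ℂ))‖ :=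
          norm_add_le _ _
      _ = ‖E₁ x‖ * ‖k * ((x⁻¹ : ℝ) : ℂ)‖ + ‖E x‖ * ‖k * ((-(x ^ 2)⁻¹ : ℝ) : ℂ)‖ := by
          simp only [norm_mul]
      _ = 2 * π * |t| * x⁻¹ * (2 * π * |t| * |x⁻¹|) + 1 * (2 * π * |t| * |(-(x ^ 2)⁻¹ : ℝ)|) := by
          rw [hE₁n x hx, hEn, hkr, hkr]
      _ = (4 * π ^ 2 * t ^ 2 + 2 * π * |t|) * (x ^ 2)⁻¹ := by
          rw [abs_of_pos (inv_pos.2 hx), abs_neg, abs_of_pos (inv_pos.2 hx2), ← sq_abs t]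
          field_simp
          ring
  have hG₁n : ∀ x, ‖G₁ x‖ ≤ |g₁ x| + 2 * π * |t| * |g x| * x⁻¹ := by
    intro x
    rcases le_or_gt x a with hx | hx
    · obtain ⟨h0, h1, -⟩ := hz x hx
      rw [(hvan x h0 h1 (hz x hx).2.2).2.1, h0, h1]; simp
    · have hx0 : 0 < x := ha.trans hx
      calc ‖G₁ x‖ ≤ ‖(g₁ x : ℂ) * E x‖ + ‖(g x : ℂ) * E₁ x‖ := norm_add_le _ _
        _ = |g₁ x| + 2 * π * |t| * |g x| * x⁻¹ := by
            rw [norm_mul (↑(g₁ x)) (E x), norm_mul (↑(g x)) (E₁ x), hEn, hE₁n x hx0,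
              Complex.norm_real, Complex.norm_real, Real.norm_eq_abs, Real.norm_eq_abs]; ring
  have hG₂n : ∀ x, ‖G₂ x‖ ≤ |g₂ x| + 4 * π * |t| * |g₁ x| * x⁻¹ +
      (4 * π ^ 2 * t ^ 2 + 2 * π * |t|) * |g x| * (x ^ 2)⁻¹ := by
    intro x
    rcases le_or_gt x a with hx | hx
    · obtain ⟨h0, h1, h2⟩ := hz x hx
      rw [(hvan x h0 h1 h2).2.2, h0, h1, h2]; simp
    · have hx0 : 0 < x := ha.trans hx
      calc ‖G₂ x‖ ≤ ‖(g₂ x : ℂ) * E x + (g₁ x : ℂ) * E₁ x‖ + ‖(g₁ x : ℂ) * E₁ x + (g x : ℂ) * E₂ x‖ :=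
            norm_add_le _ _
        _ ≤ (‖(g₂ x : ℂ) * E x‖ + ‖(g₁ x : ℂ) * E₁ x‖) +
              (‖(g₁ x : ℂ) * E₁ x‖ + ‖(g x : ℂ) * E₂ x‖) := add_le_add (norm_add_le _ _) (norm_add_le _ _)
        _ ≤ (|g₂ x| + |g₁ x| * (2 * π * |t| * x⁻¹)) + (|g₁ x| * (2 * π * |t| * x⁻¹) +
              |g x| * ((4 * π ^ 2 * t ^ 2 + 2 * π * |t|) * (x ^ 2)⁻¹)) := by
            rw [norm_mul (↑(g₂ x)) (E x), norm_mul (↑(g₁ x)) (E₁ x), norm_mul (↑(g x)) (E₂ x), hEn,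
              hE₁n x hx0, Complex.norm_real, Complex.norm_real, Complex.norm_real, Real.norm_eq_abs,
              Real.norm_eq_abs, Real.norm_eq_abs, mul_one]
            gcongr
            exact hE₂n x hx0
        _ = _ := by ring
  exact ⟨G, G₁, G₂, fun x => rfl, hGd, hG₁d, hG₂m, hGn, hG₁n, hG₂n, hvan⟩


/-! ### `L¹` norms of `G`, `G'`, `G''` -/

/-- `∫_{[a,3b]} dx/x = log(3b/a)` and `∫_{[a,3b]} dx/x² ≤ 1/a`, `∫_{[a,2a]} 1 = a`. [folklore] -/
private theorem aux_integrals {a b : ℝ} (ha : 0 < a) (hab : a ≤ b) :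
    (∫ x in Icc a (3 * b), x⁻¹) = Real.log (3 * b / a) ∧
      (∫ x in Icc a (3 * b), (x ^ 2)⁻¹) ≤ a⁻¹ ∧
      IntegrableOn (fun x : ℝ => x⁻¹) (Icc a (3 * b)) ∧
      IntegrableOn (fun x : ℝ => (x ^ 2)⁻¹) (Icc a (3 * b)) := by
  have hb : 0 < b := ha.trans_le hab
  have h3b : a ≤ 3 * b := by linarith
  have hpos : ∀ x ∈ Icc a (3 * b), (0 : ℝ) < x := fun x hx => ha.trans_le hx.1
  have hc1 : ContinuousOn (fun x : ℝ => x⁻¹) (Icc a (3 * b)) :=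
    continuousOn_inv₀.mono fun x hx => (hpos x hx).ne'
  have hc2 : ContinuousOn (fun x : ℝ => (x ^ 2)⁻¹) (Icc a (3 * b)) :=
    (continuousOn_pow 2).inv₀ fun x hx => (pow_pos (hpos x hx) 2).ne'
  refine ⟨?_, ?_, hc1.integrableOn_Icc, hc2.integrableOn_Icc⟩
  · rw [integral_Icc_eq_integral_Ioc, ← intervalIntegral.integral_of_le h3b,
      integral_inv_of_pos ha (by positivity)]
  · have hEq : EqOn (fun x : ℝ => (x ^ 2)⁻¹) (fun x => x ^ (-2 : ℝ)) (Ioc a (3 * b)) := by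
      intro x hx
      have hx0 : 0 < x := ha.trans hx.1
      simp only
      rw [Real.rpow_neg hx0.le, show (2 : ℝ) = (2 : ℕ) by norm_num, Real.rpow_natCast]
    rw [integral_Icc_eq_integral_Ioc, setIntegral_congr_fun measurableSet_Ioc hEq,
      ← intervalIntegral.integral_of_le h3b,
      integral_rpow (Or.inr ⟨by norm_num, Set.notMem_uIcc_of_lt ha (by positivity)⟩)]
    rw [show (-2 : ℝ) + 1 = -1 by norm_num, Real.rpow_neg_one, Real.rpow_neg_one]
    have : 0 < (3 * b)⁻¹ := by positivity
    have h' : ((3 * b)⁻¹ - a⁻¹) / (-1 : ℝ) = a⁻¹ - (3 * b)⁻¹ := by ring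
    rw [h']
    linarith

/-- The `L¹` bounds: with the cutoff data of `exists_smooth_cutoff` (constant `c`, scales `a ≤ b`)
and the pointwise bounds of `twist_derivs`, `‖G‖₁ ≤ 3b`, `‖G'‖₁ ≤ 2c + 2π|t| log(3b/a)`,
`‖G''‖₁ ≤ (2c(1 + 4π|t|) + 4π²t² + 2π|t|)/a`. [folklore] -/
private theorem twist_integral_bounds {g g₁ g₂ : ℝ → ℝ} {G G₁ G₂ : ℝ → ℂ} {a b c t : ℝ}
    (ha : 0 < a) (hab : a ≤ b) (hc : 0 ≤ c)
    (hg0 : ∀ x, 0 ≤ g x) (hg1 : ∀ x, g x ≤ 1)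
    (hza : ∀ x, x ≤ a → g x = 0 ∧ g₁ x = 0 ∧ g₂ x = 0)
    (hzb : ∀ x, 3 * b ≤ x → g x = 0 ∧ g₁ x = 0 ∧ g₂ x = 0)
    (hzm : ∀ x, 2 * a ≤ x → x ≤ 2 * b → g₁ x = 0 ∧ g₂ x = 0)
    (hba : ∀ x, x ≤ 2 * a → |g₁ x| ≤ c / a ∧ |g₂ x| ≤ c / a ^ 2)
    (hbb : ∀ x, 2 * b ≤ x → |g₁ x| ≤ c / b ∧ |g₂ x| ≤ c / b ^ 2)
    (hGm : AEStronglyMeasurable G) (hG₁m : AEStronglyMeasurable G₁) (hG₂m : AEStronglyMeasurable G₂)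
    (hGn : ∀ x, ‖G x‖ = |g x|)
    (hG₁n : ∀ x, ‖G₁ x‖ ≤ |g₁ x| + 2 * π * |t| * |g x| * x⁻¹)
    (hG₂n : ∀ x, ‖G₂ x‖ ≤ |g₂ x| + 4 * π * |t| * |g₁ x| * x⁻¹ +
      (4 * π ^ 2 * t ^ 2 + 2 * π * |t|) * |g x| * (x ^ 2)⁻¹) :
    Integrable G ∧ Integrable G₁ ∧ Integrable G₂ ∧
      (∫ x, ‖G x‖) ≤ 3 * b ∧
      (∫ x, ‖G₁ x‖) ≤ 2 * c + 2 * π * |t| * Real.log (3 * b / a) ∧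
      (∫ x, ‖G₂ x‖) ≤ (2 * c * (1 + 4 * π * |t|) + (4 * π ^ 2 * t ^ 2 + 2 * π * |t|)) / a := by
  have hb : 0 < b := ha.trans_le hab
  obtain ⟨hIlog, hIsq, hIO1, hIO2⟩ := aux_integrals ha hab
  -- where things vanish / pointwise indicator bounds
  have hg_ind : ∀ x, |g x| ≤ (Icc a (3 * b)).indicator (fun _ => (1 : ℝ)) x := by
    intro x
    by_cases hx : x ∈ Icc a (3 * b)
    · rw [indicator_of_mem hx, abs_of_nonneg (hg0 x)]; exact hg1 x
    · rw [indicator_of_notMem hx]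
      rw [mem_Icc, not_and_or, not_le, not_le] at hx
      rcases hx with hx | hx
      · rw [(hza x hx.le).1, abs_zero]
      · rw [(hzb x hx.le).1, abs_zero]
  have hg₁_ind : ∀ x, |g₁ x| ≤ (Icc a (2 * a)).indicator (fun _ => c / a) x +
      (Icc (2 * b) (3 * b)).indicator (fun _ => c / b) x := by
    intro x
    have h1 : 0 ≤ (Icc a (2 * a)).indicator (fun _ => c / a) x :=
      indicator_nonneg (fun _ _ => by positivity) x
    have h2 : 0 ≤ (Icc (2 * b) (3 * b)).indicator (fun _ => c / b) x :=
      indicator_nonneg (fun _ _ => by positivity) x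
    by_cases hx1 : x ∈ Icc a (2 * a)
    · rw [indicator_of_mem hx1]; linarith [(hba x hx1.2).1]
    by_cases hx2 : x ∈ Icc (2 * b) (3 * b)
    · rw [indicator_of_mem hx2]; linarith [(hbb x hx2.1).1]
    rw [indicator_of_notMem hx1, indicator_of_notMem hx2]
    rw [mem_Icc, not_and_or, not_le, not_le] at hx1 hx2
    have : g₁ x = 0 := by
      rcases hx1 with h | h
      · exact (hza x h.le).2.1
      · rcases hx2 with h' | h'
        · exact (hzm x h.le h'.le).1
        · exact (hzb x h'.le).2.1
    rw [this, abs_zero]; linarith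
  have hg₂_ind : ∀ x, |g₂ x| ≤ (Icc a (2 * a)).indicator (fun _ => c / a ^ 2) x +
      (Icc (2 * b) (3 * b)).indicator (fun _ => c / b ^ 2) x := by
    intro x
    have h1 : 0 ≤ (Icc a (2 * a)).indicator (fun _ => c / a ^ 2) x :=
      indicator_nonneg (fun _ _ => by positivity) x
    have h2 : 0 ≤ (Icc (2 * b) (3 * b)).indicator (fun _ => c / b ^ 2) x :=
      indicator_nonneg (fun _ _ => by positivity) x
    by_cases hx1 : x ∈ Icc a (2 * a)
    · rw [indicator_of_mem hx1]; linarith [(hba x hx1.2).2]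
    by_cases hx2 : x ∈ Icc (2 * b) (3 * b)
    · rw [indicator_of_mem hx2]; linarith [(hbb x hx2.1).2]
    rw [indicator_of_notMem hx1, indicator_of_notMem hx2]
    rw [mem_Icc, not_and_or, not_le, not_le] at hx1 hx2
    have : g₂ x = 0 := by
      rcases hx1 with h | h
      · exact (hza x h.le).2.2
      · rcases hx2 with h' | h'
        · exact (hzm x h.le h'.le).2
        · exact (hzb x h'.le).2.2
    rw [this, abs_zero]; linarith
  -- `|g x| x⁻¹ ≤ 1_{[a,3b]} x⁻¹`, `|g x| x⁻² ≤ 1_{[a,3b]} x⁻²`, `|g₁ x| x⁻¹ ≤ …`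
  have hgx : ∀ x, |g x| * x⁻¹ ≤ (Icc a (3 * b)).indicator (fun x => x⁻¹) x := by
    intro x
    by_cases hx : x ∈ Icc a (3 * b)
    · rw [indicator_of_mem hx]
      have hx0 : 0 < x := ha.trans_le hx.1
      have h1 : |g x| ≤ 1 := by rw [abs_of_nonneg (hg0 x)]; exact hg1 x
      calc |g x| * x⁻¹ ≤ 1 * x⁻¹ := mul_le_mul_of_nonneg_right h1 (inv_pos.2 hx0).le
        _ = x⁻¹ := one_mul _
    · rw [indicator_of_notMem hx]
      have := hg_ind x; rw [indicator_of_notMem hx] at this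
      have h0 : |g x| = 0 := le_antisymm this (abs_nonneg _)
      rw [h0, zero_mul]
  have hgx2 : ∀ x, |g x| * (x ^ 2)⁻¹ ≤ (Icc a (3 * b)).indicator (fun x => (x ^ 2)⁻¹) x := by
    intro x
    by_cases hx : x ∈ Icc a (3 * b)
    · rw [indicator_of_mem hx]
      have h1 : |g x| ≤ 1 := by rw [abs_of_nonneg (hg0 x)]; exact hg1 x
      calc |g x| * (x ^ 2)⁻¹ ≤ 1 * (x ^ 2)⁻¹ := mul_le_mul_of_nonneg_right h1 (by positivity)
        _ = (x ^ 2)⁻¹ := one_mul _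
    · rw [indicator_of_notMem hx]
      have := hg_ind x; rw [indicator_of_notMem hx] at this
      have h0 : |g x| = 0 := le_antisymm this (abs_nonneg _)
      rw [h0, zero_mul]
  have hg₁x : ∀ x, |g₁ x| * x⁻¹ ≤ (Icc a (2 * a)).indicator (fun _ => c / a ^ 2) x +
      (Icc (2 * b) (3 * b)).indicator (fun _ => c / b ^ 2) x := by
    intro x
    have h1 : 0 ≤ (Icc a (2 * a)).indicator (fun _ => c / a ^ 2) x :=
      indicator_nonneg (fun _ _ => by positivity) x
    have h2 : 0 ≤ (Icc (2 * b) (3 * b)).indicator (fun _ => c / b ^ 2) x :=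
      indicator_nonneg (fun _ _ => by positivity) x
    by_cases hx1 : x ∈ Icc a (2 * a)
    · rw [indicator_of_mem hx1]
      have hx0 : 0 < x := ha.trans_le hx1.1
      have hinv : x⁻¹ ≤ a⁻¹ := by rw [inv_le_inv₀ hx0 ha]; exact hx1.1
      have := (hba x hx1.2).1
      calc |g₁ x| * x⁻¹ ≤ (c / a) * a⁻¹ := mul_le_mul this hinv (inv_pos.2 hx0).le (by positivity)
        _ = c / a ^ 2 := by field_simp
        _ ≤ _ := by linarith
    by_cases hx2 : x ∈ Icc (2 * b) (3 * b)
    · rw [indicator_of_mem hx2, indicator_of_notMem hx1]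
      have hx0 : 0 < x := by linarith [hx2.1]
      have hinv : x⁻¹ ≤ b⁻¹ := by rw [inv_le_inv₀ hx0 hb]; linarith [hx2.1]
      have := (hbb x hx2.1).1
      calc |g₁ x| * x⁻¹ ≤ (c / b) * b⁻¹ := mul_le_mul this hinv (inv_pos.2 hx0).le (by positivity)
        _ = c / b ^ 2 := by field_simp
        _ ≤ _ := by linarith
    have := hg₁_ind x
    rw [indicator_of_notMem hx1, indicator_of_notMem hx2] at this ⊢
    have h0 : |g₁ x| = 0 := le_antisymm (by linarith) (abs_nonneg _)
    rw [h0, zero_mul]; linarith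
  -- the majorants
  set M0 : ℝ → ℝ := (Icc a (3 * b)).indicator (fun _ => (1 : ℝ)) with hM0
  set M1 : ℝ → ℝ := fun x => (Icc a (2 * a)).indicator (fun _ => c / a) x +
      (Icc (2 * b) (3 * b)).indicator (fun _ => c / b) x +
      2 * π * |t| * (Icc a (3 * b)).indicator (fun x => x⁻¹) x with hM1
  set M2 : ℝ → ℝ := fun x => (Icc a (2 * a)).indicator (fun _ => c / a ^ 2) x +
      (Icc (2 * b) (3 * b)).indicator (fun _ => c / b ^ 2) x +
      4 * π * |t| * ((Icc a (2 * a)).indicator (fun _ => c / a ^ 2) x +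
        (Icc (2 * b) (3 * b)).indicator (fun _ => c / b ^ 2) x) +
      (4 * π ^ 2 * t ^ 2 + 2 * π * |t|) * (Icc a (3 * b)).indicator (fun x => (x ^ 2)⁻¹) x with hM2
  have hdom0 : ∀ x, ‖G x‖ ≤ M0 x := fun x => by rw [hGn]; exact hg_ind x
  have hdom1 : ∀ x, ‖G₁ x‖ ≤ M1 x := by
    intro x
    refine (hG₁n x).trans ?_
    have h1 := hg₁_ind x
    have h2 := hgx x
    have ht : 0 ≤ 2 * π * |t| := by positivity
    simp only [hM1]
    nlinarith [mul_le_mul_of_nonneg_left h2 ht]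
  have hdom2 : ∀ x, ‖G₂ x‖ ≤ M2 x := by
    intro x
    refine (hG₂n x).trans ?_
    have h1 := hg₂_ind x
    have h2 := hg₁x x
    have h3 := hgx2 x
    have ht : 0 ≤ 4 * π * |t| := by positivity
    have ht2 : 0 ≤ 4 * π ^ 2 * t ^ 2 + 2 * π * |t| := by positivity
    simp only [hM2]
    nlinarith [mul_le_mul_of_nonneg_left h2 ht, mul_le_mul_of_nonneg_left h3 ht2]
  -- integrability of the majorants
  have hfin : ∀ (u v : ℝ) (C : ℝ), Integrable ((Icc u v).indicator fun _ : ℝ => C) := by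
    intro u v C
    exact (integrableOn_const (hs := by rw [Real.volume_Icc]; exact ENNReal.ofReal_ne_top)).integrable_indicator measurableSet_Icc
  have hI0 : Integrable M0 := hfin _ _ _
  have hIinv : Integrable ((Icc a (3 * b)).indicator fun x : ℝ => x⁻¹) :=
    hIO1.integrable_indicator measurableSet_Icc
  have hIsq' : Integrable ((Icc a (3 * b)).indicator fun x : ℝ => (x ^ 2)⁻¹) :=
    hIO2.integrable_indicator measurableSet_Icc
  have hI1 : Integrable M1 := by
    simp only [hM1]
    exact ((hfin _ _ _).add (hfin _ _ _)).add (hIinv.const_mul _)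
  have hI2 : Integrable M2 := by
    simp only [hM2]
    exact (((hfin _ _ _).add (hfin _ _ _)).add (((hfin _ _ _).add (hfin _ _ _)).const_mul _)).add
      (hIsq'.const_mul _)
  -- integrals of the majorants
  have hJc : ∀ (u v C : ℝ), u ≤ v → ∫ x, (Icc u v).indicator (fun _ : ℝ => C) x = C * (v - u) := by
    intro u v C huv
    rw [integral_indicator measurableSet_Icc, setIntegral_const, Real.volume_real_Icc_of_le huv,
      smul_eq_mul, mul_comm]
  have hJ0 : ∫ x, M0 x = 3 * b - a := by
    rw [hM0, hJc _ _ _ (by linarith), one_mul]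
  have hJinv : ∫ x, (Icc a (3 * b)).indicator (fun x : ℝ => x⁻¹) x = Real.log (3 * b / a) := by
    rw [integral_indicator measurableSet_Icc, hIlog]
  have hJsq : ∫ x, (Icc a (3 * b)).indicator (fun x : ℝ => (x ^ 2)⁻¹) x ≤ a⁻¹ := by
    rw [integral_indicator measurableSet_Icc]; exact hIsq
  have hJ1 : ∫ x, M1 x = 2 * c + 2 * π * |t| * Real.log (3 * b / a) := by
    have iA : Integrable (fun x => (Icc a (2 * a)).indicator (fun _ => c / a) x +
        (Icc (2 * b) (3 * b)).indicator (fun _ => c / b) x) := (hfin _ _ _).add (hfin _ _ _)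
    have iB : Integrable (fun x => 2 * π * |t| * (Icc a (3 * b)).indicator (fun x : ℝ => x⁻¹) x) :=
      hIinv.const_mul _
    simp only [hM1]
    rw [integral_add iA iB, integral_add (hfin _ _ _) (hfin _ _ _), integral_const_mul,
      hJc _ _ _ (by linarith), hJc _ _ _ (by linarith), hJinv]
    field_simp
    ring
  have hJ2 : ∫ x, M2 x ≤ (2 * c * (1 + 4 * π * |t|) + (4 * π ^ 2 * t ^ 2 + 2 * π * |t|)) / a := by
    have iA : Integrable (fun x => (Icc a (2 * a)).indicator (fun _ => c / a ^ 2) x +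
        (Icc (2 * b) (3 * b)).indicator (fun _ => c / b ^ 2) x) := (hfin _ _ _).add (hfin _ _ _)
    have iB : Integrable (fun x => 4 * π * |t| * ((Icc a (2 * a)).indicator (fun _ => c / a ^ 2) x +
        (Icc (2 * b) (3 * b)).indicator (fun _ => c / b ^ 2) x)) := iA.const_mul _
    have iC : Integrable (fun x => (4 * π ^ 2 * t ^ 2 + 2 * π * |t|) *
        (Icc a (3 * b)).indicator (fun x : ℝ => (x ^ 2)⁻¹) x) := hIsq'.const_mul _
    have iAB : Integrable (fun x => (Icc a (2 * a)).indicator (fun _ => c / a ^ 2) x +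
        (Icc (2 * b) (3 * b)).indicator (fun _ => c / b ^ 2) x +
        4 * π * |t| * ((Icc a (2 * a)).indicator (fun _ => c / a ^ 2) x +
          (Icc (2 * b) (3 * b)).indicator (fun _ => c / b ^ 2) x)) := iA.add iB
    simp only [hM2]
    rw [integral_add iAB iC, integral_add iA iB, integral_const_mul, integral_const_mul,
      integral_add (hfin _ _ _) (hfin _ _ _), hJc _ _ _ (by linarith), hJc _ _ _ (by linarith)]
    have e1 : c / a ^ 2 * (2 * a - a) = c / a := by field_simp; ring
    have e2 : c / b ^ 2 * (3 * b - 2 * b) = c / b := by field_simp; ring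
    rw [e1, e2]
    have hcb : c / b ≤ c / a := div_le_div_of_nonneg_left hc ha hab
    have ht : 0 ≤ 4 * π * |t| := by positivity
    have ht2 : 0 ≤ 4 * π ^ 2 * t ^ 2 + 2 * π * |t| := by positivity
    have hlast := mul_le_mul_of_nonneg_left hJsq ht2
    have h1 := mul_le_mul_of_nonneg_left hcb ht
    have hR : (2 * c * (1 + 4 * π * |t|) + (4 * π ^ 2 * t ^ 2 + 2 * π * |t|)) / a =
        c / a + c / a + 4 * π * |t| * (c / a + c / a) + (4 * π ^ 2 * t ^ 2 + 2 * π * |t|) * a⁻¹ := by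
      field_simp; ring
    rw [hR]
    linarith
  -- conclusions
  have hi0 : Integrable G := Integrable.mono' hI0 hGm (Eventually.of_forall hdom0)
  have hi1 : Integrable G₁ := Integrable.mono' hI1 hG₁m (Eventually.of_forall hdom1)
  have hi2 : Integrable G₂ := Integrable.mono' hI2 hG₂m (Eventually.of_forall hdom2)
  refine ⟨hi0, hi1, hi2, ?_, ?_, ?_⟩
  · calc (∫ x, ‖G x‖) ≤ ∫ x, M0 x := integral_mono hi0.norm hI0 hdom0
      _ = 3 * b - a := hJ0
      _ ≤ 3 * b := by linarith
  · calc (∫ x, ‖G₁ x‖) ≤ ∫ x, M1 x := integral_mono hi1.norm hI1 hdom1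
      _ = _ := hJ1
  · calc (∫ x, ‖G₂ x‖) ≤ ∫ x, M2 x := integral_mono hi2.norm hI2 hdom2
      _ ≤ _ := hJ2


/-! ### Assembly: the `x`-side kernel -/

/-- `‖exp(2πi u x)‖ = 1`. [folklore] -/
private theorem norm_cexp_char (u x : ℝ) : ‖Complex.exp (2 * π * I * u * x)‖ = 1 := by
  rw [show (2 * π * I * u * x : ℂ) = ((2 * π * u * x : ℝ) : ℂ) * I by push_cast; ring]
  exact Complex.norm_exp_ofReal_mul_I _

set_option maxHeartbeats 800000 in
/-- **The `x`-side separation kernel of (12.13)–(12.14).**  There is an absolute `K > 0` such that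
for all `0 < a ≤ b` there is a continuous cutoff `g : ℝ → [0,1]` with `g = 1` on `[2a, 2b]`, `g = 0`
on `(-∞, a] ∪ [3b, ∞)` — FI's "function `g(x)` whose graph is" the trapezoid of p. 47, with
`a = 2S/(HR)·½`, `b = S/R` — and, for every real `t`, an integrable kernel `Ĝ_t` with
`g(|x|) |x|^{2πit} = ∫ Ĝ_t(u) e(ux) du` for ALL real `x` and
`∫ |Ĝ_t(u)| du ≤ K (1 + |t|)² (1 + log(b/a))²`
("integrating the Fourier transform by parts up to two times we get
`∫₀^∞ x^{it} g(x) cos(2πux) dx ≪ (t²+1) min{S/R, 1/|u|, HR/(u²S)} log 2H`", whose `u`-integral is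
`≪ (t²+1)(log 2H)²`; here `b/a = H`).  Together with `exists_majorant_mellinKernel` (the `y`-side)
this is the separation of variables `f(|x|y) g(|x|) = ∬ h(u,t) e(ux) y^{it} du dt`,
`∬|h| ≪ (log 2H)²`, of (12.13)–(12.14). [cite: FriedlanderIwaniecAnnals1998, §12 (12.13)–(12.14)] -/
theorem exists_cutoff_fourierKernel :
    ∃ K : ℝ, 0 < K ∧ ∀ (a b : ℝ), 0 < a → a ≤ b →
      ∃ g : ℝ → ℝ, Continuous g ∧ (∀ x, 0 ≤ g x) ∧ (∀ x, g x ≤ 1) ∧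
        (∀ x ∈ Icc (2 * a) (2 * b), g x = 1) ∧ (∀ x, x ≤ a → g x = 0) ∧ (∀ x, 3 * b ≤ x → g x = 0) ∧
        ∀ t : ℝ, ∃ Ĝ : ℝ → ℂ, Integrable Ĝ ∧
          (∫ u, ‖Ĝ u‖) ≤ K * (1 + |t|) ^ 2 * (1 + Real.log (b / a)) ^ 2 ∧
          ∀ x : ℝ, ((g |x| : ℝ) : ℂ) * Complex.exp (2 * π * I * t * (Real.log |x| : ℝ)) =
            ∫ u, Ĝ u * Complex.exp (2 * π * I * u * x) := by
  obtain ⟨c, hc0, hcut⟩ := exists_smooth_cutoff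
  refine ⟨28 + 12 * c, by positivity, fun a b ha hab => ?_⟩
  have hb : 0 < b := ha.trans_le hab
  obtain ⟨g, g₁, g₂, hgc, hg₁c, hg₂c, hgd, hg₁d, hg0, hg1, hone, hza, hzb, hzm, hba, hbb⟩ :=
    hcut a b ha hab
  refine ⟨g, hgc, hg0, hg1, hone, fun x hx => (hza x hx).1, fun x hx => (hzb x hx).1, fun t => ?_⟩
  obtain ⟨G, G₁, G₂, hGdef, hGd, hG₁d, hG₂m, hGn, hG₁n, hG₂n, hvan⟩ :=
    twist_derivs ha hgd hg₁d hg₂c hza t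
  have hGc : Continuous G := continuous_iff_continuousAt.2 fun x => (hGd x).continuousAt
  have hG₁c : Continuous G₁ := continuous_iff_continuousAt.2 fun x => (hG₁d x).continuousAt
  obtain ⟨hGi, hG₁i, hG₂i, hI0, hI1, hI2⟩ := twist_integral_bounds ha hab hc0 hg0 hg1 hza hzb hzm
    hba hbb hGc.aestronglyMeasurable hG₁c.aestronglyMeasurable hG₂m.aestronglyMeasurable hGn hG₁n
    hG₂n
  -- the three Fourier bounds
  have hdec := fun u => fourier_decay_of_two_derivs hGi hG₁i hG₂i hGd hG₁d u
  set L : ℝ := Real.log (b / a) with hL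
  have hL0 : 0 ≤ L := Real.log_nonneg (by rw [le_div_iff₀ ha, one_mul]; exact hab)
  have hlog3 : Real.log (3 * b / a) ≤ 2 + L := by
    rw [show 3 * b / a = 3 * (b / a) by ring, Real.log_mul (by norm_num) (by positivity)]
    have : Real.log 3 ≤ 2 := by
      have := Real.log_le_sub_one_of_pos (by norm_num : (0:ℝ) < 3); linarith
    linarith
  set A₀ : ℝ := 3 * b with hA₀
  set A₁ : ℝ := (2 * c + 2 * π * |t| * (2 + L)) / (2 * π) with hA₁
  set A₂ : ℝ := (2 * c * (1 + 4 * π * |t|) + (4 * π ^ 2 * t ^ 2 + 2 * π * |t|)) / a / (4 * π ^ 2)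
    with hA₂
  have hA₁0 : 0 ≤ A₁ := by positivity
  have hA₂0 : 0 ≤ A₂ := by positivity
  have h0 : ∀ u, ‖𝓕 G u‖ ≤ A₀ := fun u => (hdec u).1.trans hI0
  have h1 : ∀ u, |u| * ‖𝓕 G u‖ ≤ A₁ := by
    intro u
    have h := (hdec u).2.1
    rw [hA₁, le_div_iff₀ (by positivity)]
    calc |u| * ‖𝓕 G u‖ * (2 * π) = 2 * π * |u| * ‖𝓕 G u‖ := by ring
      _ ≤ ∫ x, ‖G₁ x‖ := h
      _ ≤ 2 * c + 2 * π * |t| * Real.log (3 * b / a) := hI1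
      _ ≤ 2 * c + 2 * π * |t| * (2 + L) := by gcongr
  have h2 : ∀ u, u ^ 2 * ‖𝓕 G u‖ ≤ A₂ := by
    intro u
    have h := (hdec u).2.2
    rw [hA₂, le_div_iff₀ (by positivity)]
    calc u ^ 2 * ‖𝓕 G u‖ * (4 * π ^ 2) = 4 * π ^ 2 * u ^ 2 * ‖𝓕 G u‖ := by ring
      _ ≤ ∫ x, ‖G₂ x‖ := h
      _ ≤ _ := hI2
  have hφc : Continuous (𝓕 G) :=
    VectorFourier.fourierIntegral_continuous Real.continuous_fourierChar (innerSL ℝ).continuous₂ hGi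
  obtain ⟨hFi, hFI⟩ :=
    integral_norm_le_of_decay hφc (by positivity) hA₁0 hA₂0 ha hab h0 h1 h2
  -- Fourier inversion for `G`
  have hinv : 𝓕⁻ (𝓕 G) = G := hGc.fourierInv_fourier_eq hGi hFi
  have hrep : ∀ y : ℝ, G y = ∫ u, 𝓕 G u * Complex.exp (2 * π * I * u * y) := by
    intro y
    rw [← congrFun hinv y, Real.fourierInv_eq']
    refine integral_congr_ae (Eventually.of_forall fun u => ?_)
    simp only [smul_eq_mul, RCLike.inner_apply, conj_trivial]
    rw [mul_comm (𝓕 G u)]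
    congr 1
    push_cast
    ring_nf
  -- integrability of the Fourier integrands
  have hchar : ∀ y : ℝ, Integrable fun u : ℝ => 𝓕 G u * Complex.exp (2 * π * I * u * y) := by
    intro y
    refine hFi.mul_bdd (c := 1) (Continuous.aestronglyMeasurable (by fun_prop))
      (Eventually.of_forall fun u => (norm_cexp_char u y).le)
  -- the kernel
  refine ⟨fun u => 𝓕 G u + 𝓕 G (-u), hFi.add hFi.comp_neg, ?_, fun x => ?_⟩
  · -- the `L¹` bound
    have hn : (∫ u, ‖𝓕 G u + 𝓕 G (-u)‖) ≤ 2 * ∫ u, ‖𝓕 G u‖ := by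
      have hsym : (∫ u, ‖𝓕 G (-u)‖) = ∫ u, ‖𝓕 G u‖ :=
        integral_neg_eq_self (fun u => ‖𝓕 G u‖) volume
      calc (∫ u, ‖𝓕 G u + 𝓕 G (-u)‖) ≤ ∫ u, (‖𝓕 G u‖ + ‖𝓕 G (-u)‖) :=
            integral_mono (hFi.add hFi.comp_neg).norm (hFi.norm.add hFi.comp_neg.norm)
              fun u => norm_add_le _ _
        _ = (∫ u, ‖𝓕 G u‖) + ∫ u, ‖𝓕 G (-u)‖ := integral_add hFi.norm hFi.comp_neg.norm
        _ = 2 * ∫ u, ‖𝓕 G u‖ := by rw [hsym]; ring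
    refine hn.trans ?_
    -- arithmetic: `2 · 2 (A₀/b + A₁ L + A₂ a) ≤ (26 + 8c)(1+|t|)²(1+L)²`
    have hπ : 3 < π := Real.pi_gt_three
    have eA₀ : A₀ / b = 3 := by rw [hA₀]; field_simp
    have eA₁ : A₁ * L = c * L / π + |t| * (2 + L) * L := by rw [hA₁]; field_simp
    have eA₂ : A₂ * a = c / (2 * π ^ 2) + 2 * c * |t| / π + t ^ 2 + |t| / (2 * π) := by
      rw [hA₂]; field_simp; ring
    have hb1 : c * L / π ≤ c * L := div_le_self (by positivity) (by linarith)
    have hb2 : c / (2 * π ^ 2) ≤ c := div_le_self hc0 (by nlinarith)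
    have hb3 : 2 * c * |t| / π ≤ c * |t| := by
      rw [div_le_iff₀ (by positivity)]
      nlinarith [mul_nonneg (mul_nonneg hc0 (abs_nonneg t)) (by linarith : (0:ℝ) ≤ π - 2)]
    have hb4 : |t| / (2 * π) ≤ |t| := div_le_self (abs_nonneg t) (by linarith)
    have ht0 : 0 ≤ |t| := abs_nonneg t
    have hP1 : (2 + L) * L ≤ 2 * (1 + L) ^ 2 := by nlinarith
    have hP2 : |t| ≤ (1 + |t|) ^ 2 := by nlinarith
    have hP3 : t ^ 2 ≤ (1 + |t|) ^ 2 := by rw [← sq_abs t]; nlinarith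
    have hP4 : L ≤ (1 + L) ^ 2 := by nlinarith
    have hP5 : (1 : ℝ) ≤ (1 + |t|) ^ 2 := by nlinarith
    have hP6 : (1 : ℝ) ≤ (1 + L) ^ 2 := by nlinarith
    set P : ℝ := (1 + |t|) ^ 2 * (1 + L) ^ 2 with hP
    have hP0 : 1 ≤ P := by rw [hP]; nlinarith
    have hLP : (1 + L) ^ 2 ≤ P := le_mul_of_one_le_left (by positivity) hP5
    have htP : (1 + |t|) ^ 2 ≤ P := le_mul_of_one_le_right (by positivity) hP6
    have s1 : c * L / π ≤ c * P := hb1.trans (by nlinarith [mul_le_mul_of_nonneg_left (hP4.trans hLP) hc0])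
    have s2 : |t| * (2 + L) * L ≤ 2 * P := by
      calc |t| * (2 + L) * L = |t| * ((2 + L) * L) := by ring
        _ ≤ (1 + |t|) ^ 2 * (2 * (1 + L) ^ 2) := mul_le_mul hP2 hP1 (by positivity) (by positivity)
        _ = 2 * P := by rw [hP]; ring
    have s3 : c / (2 * π ^ 2) ≤ c * P := hb2.trans (le_mul_of_one_le_right hc0 hP0)
    have s4 : 2 * c * |t| / π ≤ c * P :=
      hb3.trans (by nlinarith [mul_le_mul_of_nonneg_left (hP2.trans htP) hc0])
    have s5 : t ^ 2 ≤ P := hP3.trans htP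
    have s6 : |t| / (2 * π) ≤ P := hb4.trans (hP2.trans htP)
    have hsum : A₀ / b + A₁ * L + A₂ * a ≤ (7 + 3 * c) * P := by
      rw [eA₀, eA₁, eA₂]; nlinarith
    calc 2 * ∫ u, ‖𝓕 G u‖ ≤ 2 * (2 * (A₀ / b + A₁ * Real.log (b / a) + A₂ * a)) := by
          gcongr
      _ ≤ 2 * (2 * ((7 + 3 * c) * P)) := by rw [← hL]; gcongr
      _ = (28 + 12 * c) * (1 + |t|) ^ 2 * (1 + Real.log (b / a)) ^ 2 := by rw [hP, ← hL]; ring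
  · -- the representation `g(|x|)|x|^{2πit} = G(x) + G(-x) = ∫ Ĝ(u) e(ux) du`
    have hI' : Integrable fun u : ℝ => 𝓕 G (-u) * Complex.exp (2 * π * I * u * x) := by
      refine ((hchar (-x)).comp_neg).congr (Eventually.of_forall fun u => ?_)
      beta_reduce
      congr 1
      push_cast
      ring
    have e1 : (fun u : ℝ => (𝓕 G u + 𝓕 G (-u)) * Complex.exp (2 * π * I * u * x)) =
        fun u => 𝓕 G u * Complex.exp (2 * π * I * u * x) +
          𝓕 G (-u) * Complex.exp (2 * π * I * u * x) := by
      funext u; ring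
    have e2 : (∫ u, 𝓕 G (-u) * Complex.exp (2 * π * I * u * x)) = G (-x) := by
      rw [hrep (-x), ← integral_neg_eq_self
        (fun u : ℝ => 𝓕 G u * Complex.exp (2 * π * I * u * (-x : ℝ))) volume]
      refine integral_congr_ae (Eventually.of_forall fun u => ?_)
      beta_reduce
      congr 1
      push_cast
      ring
    have hsplit : (∫ u, (𝓕 G u + 𝓕 G (-u)) * Complex.exp (2 * π * I * u * x)) =
        G x + G (-x) := by
      rw [e1, integral_add (hchar x) hI', ← hrep x, e2]
    rw [hsplit]
    rcases le_or_gt 0 x with hx | hx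
    · have hmx : -x ≤ a := by linarith
      obtain ⟨hz0, hz1, hz2⟩ := hza (-x) hmx
      rw [(hvan (-x) hz0 hz1 hz2).1, add_zero, hGdef x, abs_of_nonneg hx]
    · have hxa : x ≤ a := by linarith
      obtain ⟨hz0, hz1, hz2⟩ := hza x hxa
      rw [(hvan x hz0 hz1 hz2).1, zero_add, hGdef (-x), abs_of_neg hx]

end Literature.NumberTheory.Sieve.FriedlanderIwaniecPrimes

end
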